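import Summits.QuantumFields.YangMills.Theorems.BalabanUVNodesN07RegimeTokFlatOfRecordSmall
import HarnessLib

/-!
# NODE O · K0ᴬ — THE (R-a) ROAD AT THE FLAT SCHEME OF RECORD MODULO PROP. 4 FOR `W`: ✓p826268 (`…SmallRadii`) displayed `RegimeTok`, `0 < a`, `dom ∈ 𝓝 1`; ✓`regimeTok_flat_ofRecord_small` inhabits
# all three for the in-the-small data `dom := {V | ‖𝔄 V‖ < t}`, `B₀ := ‖𝔊(1)‖`, `j := 0`, `a = ε₄ := t` from (R2) `QuadAnalytic W C₄ a₃` alone — so the road displays ONLY: N07's KNIT tokens (for that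
# scheme), (R2), «Sect. C ∕ Prop. 6 radii small: `0 < a₃ ≤ ε_C ≤ t₀`», the `G′` row, `Delta2Tok ∧ Delta2SymmTok`, the chart letter, (J-crit′)∕(J-cons′) ([15] Prop. 4 p. 292, Prop. 6 p. 295, Prop. 9 p. 309)

Cell `pub-ymgap`, width seat `pub-ymgap-dag-n07-w3` (g27), CLAIM-15 — BY-NAME KNIT; `--kind proof --supports stmt-QuantumFields-27238 --as helper`; count-neutral.
[15] = [Balaban1985Variational]; [B9] = [Balaban1985BackgroundPropagators]; [I] = [Balaban1987RG1].

CONTENTS.  ★★★★ `rootedReceipts_of_tokens_atScale_recordScheme_of_prop4W` (`U₀ = 1`, `N = 2`, level `k + 1`, `k + 2 ≤ m + K`): `∃ t₀ > 0` such that for all `G′`, `Δ2`, `hposπ`, `ε_C`, `C₄`, `a₃`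
with `0 ≤ C₄`, `0 < a₃ ≤ ε_C ≤ t₀`, (R2), the `G′` row, the `Δ2` tokens and the chart letter, THERE IS `t > 0` such that for the scheme `S := bgSchemeOfRecord … 1 {‖𝔄 V‖ < t} … ‖𝔊‖ C₄ a₃ 0 t t`:
N07's KNIT tokens for `S` + (J-crit′)∕(J-cons′) ⟹ (∀ a l, the four rooted receipts) ∧ TokP9reg♭ᵣ.

HONEST LABELS.  EXISTENTIAL, NON-UNIFORM constants throughout (one finite torus; NOT Bałaban's `O(1)` Props 3–4 ∕ [B9] Thm 3.13); (R2) = Prop. 4 for `W = (δ∕δA′)V` and the KNIT tokens (Prop. 7 ∕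
Thm 1 content) and the dictionaries stay DISPLAYED; K0ᴬ NOT closed; N07 NOT discharged; P0 ⟨26900⟩ OPEN; R4 is the conditional finite-𝕋⁴ rung only.  Nothing here is a claim about the Yang–Mills
mass gap (`Summit.QuantumFields`): finite torus, fixed `ε`; nothing continuum ∕ OS ∕ Clay.
-/

set_option autoImplicit false

noncomputable section

open Filter Topology
open scoped BigOperators Matrix.Norms.L2Operator InnerProductSpace

namespace Summit.QuantumFields.YangMills.Theorems.K0AxTangentSocketOntoOfProp4W

open Literature.MathematicalPhysics.QuantumFieldTheory.Balaban1983to89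
open Literature.MathematicalPhysics.QuantumFieldTheory.Balaban1983to89.T4Continuum (T4Family)
open Literature.MathematicalPhysics.QuantumFieldTheory.Balaban1983to89.Node00
open B12GaugeOrbits021 (OrbitRel)
open B11Prop6Scheme (mapT)
open B13Contraction113 (QuadAnalytic)
open B9Eq311TracePairing (starW)
open B11Eq103H1Complex (BondL2K SiteL2K)
open B15DeterminingSets (MSField avgFamily atScale)
open NormedSpace (exp)
open Summit.QuantumFields.YangMills.Theorems.K0RecordFormatNames
open Summit.QuantumFields.YangMills.Theorems.K0AxRootGrad
open Summit.QuantumFields.YangMills.Theorems.K0AxCtabUniq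
open Summit.QuantumFields.YangMills.Theorems.N07TraceSectorDefs (scalPartW)
open Summit.QuantumFields.YangMills.Theorems.K0AxTangentSocketOntoSmallRadii (rootedReceipts_of_tokens_atScale_recordScheme_smallRadii)
open Summit.QuantumFields.YangMills.Theorems.N07RegimeTokFlatOfRecordSmall (regimeTok_flat_ofRecord_small frakADom_mem_nhds_one)

variable (F : T4Family) (θ : Stage13Params F 2) (k K : ℕ) [Fact (0 < (F.L : ℝ))] [Fact (0 < (F.P K).eta (k + 1))] [Fact (0 < c0Rec F K (k + 1))]
  [Fact (∀ c, 0 < wBRec F K (k + 1) c)]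
  (Ω : ℕ → Set (Site (F.P K) 0)) (levB : PBond (F.P K) (k + 1) → ℕ) (a : ℝ)
  (hposb : ∀ x, x ≠ 0 → 0 < RCLike.re ⟪x, laplaceAOfRecord F 2 (k + 1) (1 : GaugeField (F.P K) 0 (SU 2))
    (QOfRecord F 2 (k + 1) (1 : GaugeField (F.P K) 0 (SU 2))) (QflatOfRecord F 2 (k + 1)) a x⟫_ℂ)
  (hQ : Function.Surjective (QOfRecord F 2 (k + 1) (1 : GaugeField (F.P K) 0 (SU 2))))

set_option maxHeartbeats 1600000 in
/-- ★★★★ **THE (R-a) ROAD AT THE FLAT SCHEME OF RECORD, MODULO PROP. 4 FOR `W` AND N07's KNIT TOKENS** (existential data; see the module docstring for the exact display).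
[cite: Balaban1985Variational, Prop. 4 (98) p.293, Prop. 6 (115)–(121) p.295, Prop. 9 p.309, (15) p.280, (19)–(20) p.281; Balaban1985BackgroundPropagators, (3.134) p.422; Balaban1987RG1, p.264;
Balaban1988Convergent, (2.10)–(2.13) pp.256–257] -/
theorem rootedReceipts_of_tokens_atScale_recordScheme_of_prop4W (hk2 : k + 2 ≤ (F.P K).m + (F.P K).K) :
    ∃ t₀ > 0, ∀ (Gp : SiteL2K ℂ (F.P K).d (fun _ => (F.P K).sitesPerDir 0) (c0Rec F K (k + 1)) (WRec 2) →ₗ[ℂ]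
        SiteL2K ℂ (F.P K).d (fun _ => (F.P K).sitesPerDir 0) (c0Rec F K (k + 1)) (WRec 2))
      (Δ2 : BondL2K ℂ (F.P K).d (fun _ => (F.P K).sitesPerDir 0) (c0Rec F K (k + 1)) (WRec 2) →ₗ[ℂ]
        BondL2K ℂ (F.P K).d (fun _ => (F.P K).sitesPerDir 0) (c0Rec F K (k + 1)) (WRec 2))
      (hposπ : ∀ x, x ≠ 0 → 0 < RCLike.re ⟪x, laplaceAOfRecordAt F 2 (k + 1) (1 : GaugeField (F.P K) 0 (SU 2))
        (hessOpOfRecord128 F 2 (k + 1) (1 : GaugeField (F.P K) 0 (SU 2)) Gp (QflatOfRecord F 2 (k + 1)) Δ2)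
        (QOfRecord F 2 (k + 1) (1 : GaugeField (F.P K) 0 (SU 2))) (QflatOfRecord F 2 (k + 1)) a x⟫_ℂ) (εC C₄ a₃ : ℝ),
      0 ≤ C₄ → 0 < a₃ → a₃ ≤ εC → εC ≤ t₀ →
      QuadAnalytic (WOfRecordAt F 2 K (k + 1) Ω (1 : GaugeField (F.P K) 0 (SU 2)) levB a hposb hQ εC Gp) C₄ a₃ →
      (∀ s, Gp (starW (phiRec 2) s) = starW (phiRec 2) (Gp s)) → (∀ s, Gp (scalPartW 2 _ s) = scalPartW 2 _ (Gp s)) →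
      Delta2Tok F 2 K (k + 1) Ω 1 levB a hposb hQ Δ2 → Delta2SymmTok F 2 K (k + 1) Ω 1 Δ2 →
      (letI := θ.instVβ₁; letI := θ.instVβ₂; ∀ v : θ.Vβ, NormedSpace.exp (θ.ρ8 v) ∈ Matrix.specialUnitaryGroup (Fin 2) ℂ) →
      ∃ t > 0, ∀ (S : BgSchemeOnLit F 2 K (k + 1) Ω 1),
        S = bgSchemeOfRecord F 2 K (k + 1) Ω 1
            {V : GaugeField (F.P K) (k + 1) (SU 2) | ‖frakAOfRecordAtBg128 F 2 K (k + 1) Ω (1 : GaugeField (F.P K) 0 (SU 2)) levB Gp Δ2 a hposπ hQ V‖ < t}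
            levB Gp Δ2 a hposπ hposb hQ εC ‖frakGOfRecordAtBg128 F 2 K (k + 1) Ω (1 : GaugeField (F.P K) 0 (SU 2)) Gp Δ2 a hposπ hQ‖ C₄ a₃ 0 t t →
        ∀ (Kc : GaugeField (F.P K) (k + 1) (SU 2) → Set (Space115Lit F 2 K (k + 1) Ω 1)),
        (∀ V ∈ S.dom, ∀ A ∈ Kc V, S.chart V A ∈ bgReg F 2 K (k + 1) θ.εbg ∧ Averaging.iter (avOfRecord F 2 K) (k + 1) (S.chart V A) = V) →
        (∀ V ∈ S.dom, ∀ U : GaugeField (F.P K) 0 (SU 2), U ∈ bgReg F 2 K (k + 1) θ.εbg →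
          Averaging.iter (avOfRecord F 2 K) (k + 1) U = V → ∃ A ∈ Kc V, OrbitRel (k + 1) (S.chart V A) U) →
        (∀ V ∈ S.dom, ∀ A ∈ Kc V, IsMinOn (wilsonAction4 ∘ S.chart V) (Kc V) A → ‖A‖ ≤ S.ε₄ ∧ mapT (S.𝒢 V) 0 (S.W V) (S.J V) (S.𝔄 V) A = A) →
        (∀ V ∈ S.dom, S.sol V ∈ Kc V) → (∀ V ∈ S.dom, IsMinOn (wilsonAction4 ∘ S.chart V) (Kc V) (S.sol V)) →
        FlatCritDictionary F k K (msChart F 2 K (k + 1) (atScale (k + 1)) (avgFamily (avOfRecord F 2 K) 1) (1 : GaugeField (F.P K) 0 (SU 2))) →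
        FlatConsDictionary F θ k K (msChart F 2 K (k + 1) (atScale (k + 1)) (avgFamily (avOfRecord F 2 K) 1) (1 : GaugeField (F.P K) 0 (SU 2)))
          (fun B => msChart F 2 K (k + 1) (atScale (k + 1)) (avgFamily (avOfRecord F 2 K) 1) (1 : GaugeField (F.P K) 0 (SU 2)) (S.lieExpo (unitField F θ k K B))) →
        (∀ (a' : θ.ιβ) (l : RespLabel F k K),
          RootedResponseCriticalModGaugeAt F θ k K a' l ∧ RootedResponseOrbitAt F θ k K a' l ∧
            RootedResponseInvCriticalAt F θ k K a' l ∧ RootedResponseConstraintModGaugeAt F θ k K a' l) ∧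
        letI := θ.instVβ₁; letI := θ.instVβ₂
        ContDiffAt ℝ 2 (fun B : Fin (F.P K).d → Site (F.P K) (k + 1) → θ.Vβ =>
          fun (b : PBond (F.P K) 0) (i i' : Fin 2) => ((recordBgField F θ k K B b : SU 2) : Matrix (Fin 2) (Fin 2) ℂ) i i') 0 := by
  obtain ⟨t₀, ht₀, hroad⟩ := rootedReceipts_of_tokens_atScale_recordScheme_smallRadii F θ k K Ω levB a hposb hQ hk2
  refine ⟨t₀, ht₀, fun Gp Δ2 hposπ εC C₄ a₃ hC₄ ha₃ ha₃ε hεt hW hGpR hGpS hΔ hs hρ => ?_⟩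
  obtain ⟨t, ht, -, -, hT⟩ := regimeTok_flat_ofRecord_small F 2 K (k + 1) Ω levB a hposπ hposb hQ (Gp := Gp) (Δ2 := Δ2) εC hC₄ ha₃ hW
  have hd := frakADom_mem_nhds_one F 2 K (k + 1) Ω levB a hposπ hQ (Gp := Gp) (Δ2 := Δ2) ht
  refine ⟨t, ht, fun S hS Kc range covers sol_of_isMinOn star_mem star_isMinOn Jcrit Jcons => ?_⟩
  have hT' : S.RegimeTok := by rw [hS]; exact hT
  exact hroad _ Gp Δ2 hposπ εC _ C₄ a₃ 0 t t S hS ha₃ ha₃ε hεt hT' ht hGpR hGpS hΔ hs hd hρ Kc range covers sol_of_isMinOn star_mem star_isMinOn Jcrit Jcons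

end Summit.QuantumFields.YangMills.Theorems.K0AxTangentSocketOntoOfProp4W

end
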